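import Literature.Analysis.FluidPDE.ElgindiDivisionBySin
import Literature.Analysis.FluidPDE.ElgindiSupBounds
import Literature.Analysis.FluidPDE.ElgindiRadialMulHk
import Literature.Analysis.Calculus.SlopeQuotient
import Literature.Analysis.Fourier.SincSmooth
import Mathlib.Analysis.SpecialFunctions.SmoothTransition
import HarnessLib

/-!
# Division by `sin 2θ` in `𝓗⁴` ([Elgindi2021] §8.5 Proposition 8.21): the strip inequality
`|Φ/sin 2θ|_{𝓗⁴} ≤ C|∂_θΦ|_{𝓗⁴}`

Topic `Literature/Analysis/FluidPDE`. Support file (definitions with bodies — the angular cut-offs of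
the quotient realisation — and proved theorems, no named facts) on the proof path of the named fact
`Literature.Analysis.FluidPDE.Elgindi.ElgindiGhoulMasmoudi2021_stabilityCore`
(`ElgindiStabilityDecomposition.lean`). T. M. Elgindi, Ann. of Math. 194 (2021) =
arXiv:1904.04795, §8.5 Proposition 8.21 (p. 28): "Let `Φ` be smooth … `Φ(z,0) = Φ(z,π/2) = 0` for
all `z`. Then `Φ/sin 2θ ∈ 𝓗⁴` and `|Φ/sin 2θ|_{𝓗⁴} ≤ C|∂_θΦ|_{𝓗⁴}`" (used in §9.2.2 for the transport
velocity `U(Φ)/sin 2θ`, and by Elgindi–Ghoul–Masmoudi, arXiv:1910.14071, §3.2 and §7).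

From the one-variable core (`ElgindiDivisionBySin`):
* **quotient realisation** (`exists_smooth_div_sin_two_mul`): a smooth `f` with `f(0) = f(π/2) = 0`
  is `sin 2θ·G` on `(0, π/2)` for a smooth `G` on `ℝ` (Hadamard quotients at both ends, `sinc`, and
  two angular cut-offs);
* **the strip inequality** (`eHkNormSq_div_sin_le`): for `Φ` smooth on `ℝ²` (`Smooth2`) vanishing on
  `θ = 0` and `θ = π/2`, and `0 < α ≤ 1`,
  `|Φ/sin 2θ|²_{𝓗⁴} ≤ 150·10³⁰·|∂_θΦ|²_{𝓗⁴}` in the tree's functional `eHkNormSq α 4`: slice by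
  slice, the radial terms by the sharp Hardy inequality and the words `D_θⁱD_zʲ`, `i + j ≤ 4`, by
  `divisionBySin_core` with `n = 4 − j`, using `D_zʲ(Φ/sin 2θ) = (D_zʲΦ)/sin 2θ` and
  `∂_θD_zʲΦ = D_zʲ∂_θΦ` on the strip.
-/

noncomputable section

open Set Real MeasureTheory Finset Function
open _root_.Topology
open scoped ContDiff ENNReal

namespace Literature.Analysis.FluidPDE

namespace Elgindi

/-! ### Differentiability orders -/

/-- Finite orders are below `∞` (private copy of a landed one-liner). [folklore] -/
private theorem natCast_le_infty' (m : ℕ) : (m : WithTop ℕ∞) ≤ ((⊤ : ℕ∞) : WithTop ℕ∞) := WithTop.coe_le_coe.2 le_top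

/-- `1 ≤ ∞` (private copy of a landed one-liner). [folklore] -/
private theorem one_le_infty' : (1 : WithTop ℕ∞) ≤ ((⊤ : ℕ∞) : WithTop ℕ∞) := WithTop.coe_le_coe.2 le_top

/-- `∞ ≠ 0` among differentiability orders. [folklore] -/
private theorem infty_ne_zero' : ((⊤ : ℕ∞) : WithTop ℕ∞) ≠ 0 := fun h => by
  have h1 : (1 : WithTop ℕ∞) ≤ 0 := h ▸ one_le_infty'
  exact absurd h1 (by norm_num)

/-! ### `sinc` -/

/-- `sin x = x·sinc x` (private copy of `Literature.Analysis.Fourier.sin_eq_mul_sinc`, not imported). [folklore] -/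
private theorem sin_eq_mul_sinc (x : ℝ) : Real.sin x = x * Real.sinc x := by
  rcases eq_or_ne x 0 with rfl | hx
  · simp
  · rw [Real.sinc_of_ne_zero hx]; field_simp

/-- `sinc ≠ 0` on `(−π, π)` (private copy of the lemma of `ElgindiHalfPiRegularity`, not imported here). [folklore] -/
private theorem sinc_ne_zero_of_mem_Ioo {σ : ℝ} (hσ : σ ∈ Ioo (-π) π) : Real.sinc σ ≠ 0 := by
  rcases eq_or_ne σ 0 with h0 | h0
  · rw [h0, Real.sinc_zero]; exact one_ne_zero
  · rw [Real.sinc_of_ne_zero h0]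
    refine div_ne_zero ?_ h0
    rcases lt_or_gt_of_ne h0 with hneg | hpos
    · exact (Real.sin_neg_of_neg_of_neg_pi_lt hneg hσ.1).ne
    · exact (Real.sin_pos_of_pos_of_lt_pi hpos hσ.2).ne'

/-! ### The angular cut-offs -/

/-- The step `S(θ)`: `0` for `θ ≤ π/8`, `1` for `θ ≥ 3π/8`. [folklore] -/
def cutStep (θ : ℝ) : ℝ := Real.smoothTransition ((θ - π / 8) / (π / 4))

/-- The lower guard: `0` for `θ ≤ −3π/8`, `1` for `θ ≥ −π/8`. [folklore] -/
def cutLow (θ : ℝ) : ℝ := Real.smoothTransition ((θ + 3 * π / 8) / (π / 4))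

/-- The upper guard: `1` for `θ ≤ 5π/8`, `0` for `θ ≥ 3π/4`. [folklore] -/
def cutHigh (θ : ℝ) : ℝ := Real.smoothTransition ((3 * π / 4 - θ) / (π / 8))

/-- The cut-off at the end `θ = 0`: `κ₀ = (1 − S)·(lower guard)`. [folklore] -/
def cutZero (θ : ℝ) : ℝ := (1 - cutStep θ) * cutLow θ

/-- The cut-off at the end `θ = π/2`: `κ₁ = S·(upper guard)`. [folklore] -/
def cutHalfPi (θ : ℝ) : ℝ := cutStep θ * cutHigh θ

/-- Smoothness of the cut-offs. [folklore] -/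
theorem contDiff_cutZero : ContDiff ℝ ∞ cutZero := by
  unfold cutZero cutStep cutLow
  exact (contDiff_const.sub (Real.smoothTransition.contDiff.comp ((contDiff_id.sub contDiff_const).div_const _))).mul
    (Real.smoothTransition.contDiff.comp ((contDiff_id.add contDiff_const).div_const _))

/-- Smoothness of the cut-offs. [folklore] -/
theorem contDiff_cutHalfPi : ContDiff ℝ ∞ cutHalfPi := by
  unfold cutHalfPi cutStep cutHigh
  exact (Real.smoothTransition.contDiff.comp ((contDiff_id.sub contDiff_const).div_const _)).mul
    (Real.smoothTransition.contDiff.comp ((contDiff_const.sub contDiff_id).div_const _))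

/-- On `[0, π/2]` the two cut-offs sum to `1`. [folklore] -/
theorem cutZero_add_cutHalfPi {θ : ℝ} (h0 : 0 ≤ θ) (h1 : θ ≤ π / 2) : cutZero θ + cutHalfPi θ = 1 := by
  have hπ := Real.pi_pos
  have hl : cutLow θ = 1 := Real.smoothTransition.one_of_one_le (by rw [le_div_iff₀ (by positivity)]; linarith)
  have hh : cutHigh θ = 1 := Real.smoothTransition.one_of_one_le (by rw [le_div_iff₀ (by positivity)]; linarith)
  simp only [cutZero, cutHalfPi, hl, hh]; ring

/-- `κ₀ = 0` for `θ ≥ 3π/8`. [folklore] -/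
theorem cutZero_eq_zero_of_ge {θ : ℝ} (h : 3 * π / 8 ≤ θ) : cutZero θ = 0 := by
  have hπ := Real.pi_pos
  have hs : cutStep θ = 1 := Real.smoothTransition.one_of_one_le (by rw [le_div_iff₀ (by positivity)]; linarith)
  simp [cutZero, hs]

/-- `κ₀ = 0` for `θ ≤ −3π/8`. [folklore] -/
theorem cutZero_eq_zero_of_le {θ : ℝ} (h : θ ≤ -(3 * π / 8)) : cutZero θ = 0 := by
  have hπ := Real.pi_pos
  have hl : cutLow θ = 0 := Real.smoothTransition.zero_of_nonpos (div_nonpos_of_nonpos_of_nonneg (by linarith) (by positivity))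
  simp [cutZero, hl]

/-- `κ₁ = 0` for `θ ≤ π/8`. [folklore] -/
theorem cutHalfPi_eq_zero_of_le {θ : ℝ} (h : θ ≤ π / 8) : cutHalfPi θ = 0 := by
  have hπ := Real.pi_pos
  have hs : cutStep θ = 0 := Real.smoothTransition.zero_of_nonpos (div_nonpos_of_nonpos_of_nonneg (by linarith) (by positivity))
  simp [cutHalfPi, hs]

/-- `κ₁ = 0` for `θ ≥ 3π/4`. [folklore] -/
theorem cutHalfPi_eq_zero_of_ge {θ : ℝ} (h : 3 * π / 4 ≤ θ) : cutHalfPi θ = 0 := by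
  have hπ := Real.pi_pos
  have hh : cutHigh θ = 0 := Real.smoothTransition.zero_of_nonpos (div_nonpos_of_nonpos_of_nonneg (by linarith) (by positivity))
  simp [cutHalfPi, hh]

/-- **Gluing**: a smooth cut-off times a function smooth on an open set, the cut-off vanishing near
every point outside the set, is smooth. [folklore] -/
theorem contDiff_mul_of_vanishing {κ A : ℝ → ℝ} {U : Set ℝ} (hU : IsOpen U) (hκ : ContDiff ℝ ∞ κ) (hA : ContDiffOn ℝ ∞ A U)
    (hz : ∀ x, x ∉ U → ∃ V ∈ 𝓝 x, ∀ y ∈ V, κ y = 0) : ContDiff ℝ ∞ fun x => κ x * A x := by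
  refine contDiff_iff_contDiffAt.2 fun x => ?_
  by_cases hx : x ∈ U
  · exact hκ.contDiffAt.mul (hA.contDiffAt (hU.mem_nhds hx))
  · obtain ⟨V, hV, hV0⟩ := hz x hx
    have hev : (fun y => κ y * A y) =ᶠ[𝓝 x] fun _ => 0 := by
      filter_upwards [hV] with y hy
      rw [hV0 y hy, zero_mul]
    exact (contDiffAt_const (c := (0 : ℝ))).congr_of_eventuallyEq hev

/-! ### The quotient realisation `f = sin 2θ·G` -/

/-- **Quotient realisation**: a smooth `f` with `f(0) = f(π/2) = 0` is `sin 2θ·G` on `(0, π/2)` for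
some smooth `G : ℝ → ℝ` (Hadamard's lemma at both ends, `sin 2θ = 2θ·sinc 2θ = (π−2θ)·sinc(π−2θ)`,
glued by the cut-offs `κ₀ + κ₁ = 1`). [folklore] -/
theorem exists_smooth_div_sin_two_mul {f : ℝ → ℝ} (hf : ContDiff ℝ ∞ f) (h0 : f 0 = 0) (h1 : f (π / 2) = 0) :
    ∃ G : ℝ → ℝ, ContDiff ℝ ∞ G ∧ ∀ θ ∈ Ioo 0 (π / 2), f θ = Real.sin (2 * θ) * G θ := by
  have hπ := Real.pi_pos
  -- Hadamard quotients at `0` and at `π/2`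
  set F₀ : ℝ × ℝ → ℝ := fun p => f p.2 with hF₀
  set F₁ : ℝ × ℝ → ℝ := fun p => f (π / 2 + p.2) with hF₁
  have hF₀s : ContDiff ℝ ∞ F₀ := hf.comp contDiff_snd
  have hF₁s : ContDiff ℝ ∞ F₁ := hf.comp (contDiff_const.add contDiff_snd)
  set q₀ : ℝ → ℝ := fun θ => Literature.Analysis.Calculus.slopeQuot F₀ ((0 : ℝ), θ) with hq₀
  set q₁ : ℝ → ℝ := fun θ => Literature.Analysis.Calculus.slopeQuot F₁ ((0 : ℝ), θ - π / 2) with hq₁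
  have hq₀s : ContDiff ℝ ∞ q₀ :=
    (Literature.Analysis.Calculus.contDiff_slopeQuot_infty hF₀s).comp (contDiff_const.prodMk contDiff_id)
  have hq₁s : ContDiff ℝ ∞ q₁ :=
    (Literature.Analysis.Calculus.contDiff_slopeQuot_infty hF₁s).comp (contDiff_const.prodMk (contDiff_id.sub contDiff_const))
  have hf₀ : ∀ θ, f θ = θ * q₀ θ := fun θ => by
    have h := Literature.Analysis.Calculus.eq_add_smul_slopeQuot hF₀s infty_ne_zero' (0 : ℝ) θ
    simp only [hF₀, h0, zero_add, smul_eq_mul] at h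
    exact h
  have hf₁ : ∀ θ, f θ = (θ - π / 2) * q₁ θ := fun θ => by
    have h := Literature.Analysis.Calculus.eq_add_smul_slopeQuot hF₁s infty_ne_zero' (0 : ℝ) (θ - π / 2)
    simp only [hF₁, add_zero, h1, zero_add, smul_eq_mul, show π / 2 + (θ - π / 2) = θ by ring] at h
    exact h
  -- the two local quotients
  set A : ℝ → ℝ := fun θ => q₀ θ / (2 * Real.sinc (2 * θ)) with hA
  set B : ℝ → ℝ := fun θ => -q₁ θ / (2 * Real.sinc (π - 2 * θ)) with hB
  have hAs : ContDiffOn ℝ ∞ A (Ioo (-(π / 2)) (π / 2)) := by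
    refine hq₀s.contDiffOn.div ((contDiff_const.mul (Literature.Analysis.Fourier.contDiff_sinc.comp (contDiff_const.mul contDiff_id))).contDiffOn)
      fun θ hθ => mul_ne_zero two_ne_zero (sinc_ne_zero_of_mem_Ioo ⟨by linarith [hθ.1], by linarith [hθ.2]⟩)
  have hBs : ContDiffOn ℝ ∞ B (Ioo 0 π) := by
    refine hq₁s.neg.contDiffOn.div ((contDiff_const.mul (Literature.Analysis.Fourier.contDiff_sinc.comp (contDiff_const.sub (contDiff_const.mul contDiff_id)))).contDiffOn)
      fun θ hθ => mul_ne_zero two_ne_zero (sinc_ne_zero_of_mem_Ioo ⟨by linarith [hθ.2], by linarith [hθ.1]⟩)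
  -- the glued quotient
  refine ⟨fun θ => cutZero θ * A θ + cutHalfPi θ * B θ, ?_, fun θ hθ => ?_⟩
  · refine (contDiff_mul_of_vanishing isOpen_Ioo contDiff_cutZero hAs fun x hx => ?_).add
      (contDiff_mul_of_vanishing isOpen_Ioo contDiff_cutHalfPi hBs fun x hx => ?_)
    · rcases le_or_gt x 0 with hle | hgt
      · have hx' : x ≤ -(π / 2) := by
          by_contra hc; exact hx ⟨lt_of_not_ge hc, by linarith⟩
        exact ⟨Iio (-(3 * π / 8)), Iio_mem_nhds (by linarith), fun y hy => cutZero_eq_zero_of_le (le_of_lt hy)⟩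
      · have hx' : π / 2 ≤ x := by
          by_contra hc; exact hx ⟨by linarith, lt_of_not_ge hc⟩
        exact ⟨Ioi (3 * π / 8), Ioi_mem_nhds (by linarith), fun y hy => cutZero_eq_zero_of_ge (le_of_lt hy)⟩
    · rcases le_or_gt x (π / 2) with hle | hgt
      · have hx' : x ≤ 0 := by
          by_contra hc; exact hx ⟨lt_of_not_ge hc, by linarith⟩
        exact ⟨Iio (π / 8), Iio_mem_nhds (by linarith), fun y hy => cutHalfPi_eq_zero_of_le (le_of_lt hy)⟩
      · have hx' : π ≤ x := by
          by_contra hc; exact hx ⟨by linarith, lt_of_not_ge hc⟩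
        exact ⟨Ioi (3 * π / 4), Ioi_mem_nhds (by linarith), fun y hy => cutHalfPi_eq_zero_of_ge (le_of_lt hy)⟩
  · -- the identity on `(0, π/2)`
    have hs0 : Real.sinc (2 * θ) ≠ 0 := sinc_ne_zero_of_mem_Ioo ⟨by linarith [hθ.1], by linarith [hθ.2]⟩
    have hs1 : Real.sinc (π - 2 * θ) ≠ 0 := sinc_ne_zero_of_mem_Ioo ⟨by linarith [hθ.2], by linarith [hθ.1]⟩
    have e0 : Real.sin (2 * θ) = 2 * θ * Real.sinc (2 * θ) := sin_eq_mul_sinc _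
    have e1 : Real.sin (2 * θ) = (π - 2 * θ) * Real.sinc (π - 2 * θ) := by rw [← sin_eq_mul_sinc, Real.sin_pi_sub]
    have hsum := cutZero_add_cutHalfPi hθ.1.le hθ.2.le
    have tA : Real.sin (2 * θ) * (cutZero θ * A θ) = cutZero θ * f θ := by
      simp only [hA]; rw [hf₀ θ, e0]; field_simp
    have tB : Real.sin (2 * θ) * (cutHalfPi θ * B θ) = cutHalfPi θ * f θ := by
      simp only [hB]; rw [hf₁ θ, e1]; field_simp; ring
    calc f θ = (cutZero θ + cutHalfPi θ) * f θ := by rw [hsum, one_mul]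
      _ = Real.sin (2 * θ) * (cutZero θ * A θ) + Real.sin (2 * θ) * (cutHalfPi θ * B θ) := by rw [tA, tB]; ring
      _ = _ := by ring

/-! ### Calculus: division by an angular function, vanishing words, commutation -/

/-- `D_z(u/c) = (D_zu)/c` for an angular function `c(θ)` (globally). [folklore] -/
theorem Dz_div_theta (u : ℝ → ℝ → ℝ) (c : ℝ → ℝ) : Dz (fun z θ => u z θ / c θ) = fun z θ => Dz u z θ / c θ := by
  funext z θ; simp only [Dz]; rw [deriv_div_const]; ring

/-- `D_zʲ(u/c) = (D_zʲu)/c` for an angular function `c(θ)`. [folklore] -/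
theorem iterate_Dz_div_theta (u : ℝ → ℝ → ℝ) (c : ℝ → ℝ) (j : ℕ) :
    Dz^[j] (fun z θ => u z θ / c θ) = fun z θ => (Dz^[j] u) z θ / c θ := by
  induction j generalizing u with
  | zero => rfl
  | succ j ih => rw [Function.iterate_succ_apply, Function.iterate_succ_apply, Dz_div_theta, ih]

/-- `D_z(c·u) = c·D_zu` for an angular function `c(θ)`. [folklore] -/
theorem Dz_theta_mul (c : ℝ → ℝ) (u : ℝ → ℝ → ℝ) : Dz (fun z θ => c θ * u z θ) = fun z θ => c θ * Dz u z θ := by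
  funext z θ; simp only [Dz]; rw [deriv_const_mul_field]; ring

/-- `D_zʲ(c·u) = c·D_zʲu` for an angular function `c(θ)`. [folklore] -/
theorem iterate_Dz_theta_mul (c : ℝ → ℝ) (u : ℝ → ℝ → ℝ) (j : ℕ) :
    Dz^[j] (fun z θ => c θ * u z θ) = fun z θ => c θ * (Dz^[j] u) z θ := by
  induction j generalizing u with
  | zero => rfl
  | succ j ih => rw [Function.iterate_succ_apply, Function.iterate_succ_apply, Dz_theta_mul, ih]

/-- The radial words vanish on an angular line where the function vanishes. [folklore] -/
theorem iterate_Dz_apply_eq_zero {u : ℝ → ℝ → ℝ} {θ₀ : ℝ} (h : ∀ z, u z θ₀ = 0) (j : ℕ) : ∀ z, (Dz^[j] u) z θ₀ = 0 := by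
  induction j generalizing u with
  | zero => exact h
  | succ j ih =>
    intro z
    rw [Function.iterate_succ_apply]
    refine ih (fun z' => ?_) z
    simp only [Dz]
    rw [show (fun z'' => u z'' θ₀) = fun _ => (0:ℝ) from funext h, deriv_const, mul_zero]

/-- **`∂_θD_zʲΦ = D_zʲ∂_θΦ` on the strip** for `Φ ∈ C^N(strip)`, `j + 2 ≤ N`. [folklore] -/
theorem dθ_iterate_Dz {Φ : ℝ → ℝ → ℝ} {N : ℕ} (hΦ : ContDiffOn ℝ N (uncurry Φ) strip) {j : ℕ} (hj : j + 2 ≤ N)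
    {p : ℝ × ℝ} (hp : p ∈ strip) : dθ (Dz^[j] Φ) p.1 p.2 = (Dz^[j] (dθ Φ)) p.1 p.2 := by
  have h := iterate_Dz_Dθ hΦ hj p hp
  have e : Dθ Φ = fun z θ => Real.sin (2 * θ) * dθ Φ z θ := by funext z θ; rfl
  rw [e, iterate_Dz_theta_mul] at h
  have hs : Real.sin (2 * p.2) ≠ 0 := (sin_two_mul_pos_of_mem hp.2).ne'
  have h' : Real.sin (2 * p.2) * (Dz^[j] (dθ Φ)) p.1 p.2 = Real.sin (2 * p.2) * dθ (Dz^[j] Φ) p.1 p.2 := h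
  exact (mul_left_cancel₀ hs h').symm

/-- Locality of the angular words on the open quarter period (the statement of
`ElgindiAngularCorrectorWords.iterate_Dθ₁_congr_Ioo`, in `∀ θ` form; kept here to avoid the import). [folklore] -/
theorem iterate_Dθ₁_congr_of_Ioo {g h : ℝ → ℝ} (hgh : ∀ θ ∈ Ioo 0 (π / 2), g θ = h θ) (a : ℕ) :
    ∀ θ ∈ Ioo 0 (π / 2), (Dθ₁^[a] g) θ = (Dθ₁^[a] h) θ := by
  induction a generalizing g h with
  | zero => exact hgh
  | succ a ih =>
    intro θ hθ
    rw [Function.iterate_succ_apply, Function.iterate_succ_apply]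
    refine ih (fun θ' hθ' => ?_) θ hθ
    simp only [Dθ₁]
    rw [Filter.EventuallyEq.deriv_eq (Filter.eventuallyEq_of_mem (isOpen_Ioo.mem_nhds hθ') hgh)]

/-- Locality of the derivative on the open quarter period. [folklore] -/
theorem deriv_congr_Ioo {g h : ℝ → ℝ} (hgh : ∀ θ ∈ Ioo 0 (π / 2), g θ = h θ) :
    ∀ θ ∈ Ioo 0 (π / 2), deriv g θ = deriv h θ := fun _ hθ =>
  Filter.EventuallyEq.deriv_eq (Filter.eventuallyEq_of_mem (isOpen_Ioo.mem_nhds hθ) hgh)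

/-! ### Smooth functions vanishing on the sides of the strip -/

section Sides

variable {Φ : ℝ → ℝ → ℝ} (hΦ : Smooth2 Φ)
include hΦ

/-- The radial words of a `Smooth2` function are smooth. [folklore] -/
theorem Smooth2.contDiff_iterate_Dz (j n : ℕ) : ContDiff ℝ n (uncurry (Dz^[j] Φ)) :=
  contDiff_iterate_Dθ_Dz_of_forall hΦ 0 j n

/-- The angular slices of the radial words are smooth. [folklore] -/
theorem Smooth2.contDiff_slice_iterate_Dz (j : ℕ) (z : ℝ) : ContDiff ℝ ∞ fun θ => (Dz^[j] Φ) z θ :=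
  contDiff_infty.2 fun n => (Smooth2.contDiff_iterate_Dz hΦ j n).comp (contDiff_const.prodMk contDiff_id)

/-- `∂_θΦ` is `Smooth2`. [folklore] -/
theorem Smooth2.smooth2_dθ : Smooth2 (dθ Φ) := fun n => contDiff_dθ_of_contDiff (hΦ (n + 1))

/-- A `Smooth2` function is `C^N` on the strip. [folklore] -/
theorem Smooth2.contDiffOn_strip (N : ℕ) : ContDiffOn ℝ N (uncurry Φ) strip := (hΦ N).contDiffOn

/-- `Φ/sin 2θ` is `C^N` on the strip. [folklore] -/
theorem Smooth2.contDiffOn_div_sin (N : ℕ) : ContDiffOn ℝ N (uncurry fun z θ => Φ z θ / Real.sin (2 * θ)) strip := by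
  have hs : ContDiffOn ℝ N (fun p : ℝ × ℝ => Real.sin (2 * p.2)) strip := by fun_prop
  exact ((hΦ N).contDiffOn.div hs fun p hp => (sin_two_mul_pos_of_mem hp.2).ne').congr fun p _ => rfl

/-- On the strip `∂_θD_zʲΦ = D_zʲ∂_θΦ` (any `j`). [folklore] -/
theorem Smooth2.dθ_iterate_Dz (j : ℕ) {p : ℝ × ℝ} (hp : p ∈ strip) : dθ (Dz^[j] Φ) p.1 p.2 = (Dz^[j] (dθ Φ)) p.1 p.2 :=
  Literature.Analysis.FluidPDE.Elgindi.dθ_iterate_Dz (Smooth2.contDiffOn_strip hΦ (j + 2)) le_rfl hp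

end Sides


/-! ### Slice integrals in `ℝ≥0∞` -/

/-- The product structure of the strip measure (private copy of the lemma of
`ElgindiVeryWeakUniqueness`, not imported here). [folklore] -/
private theorem volume_restrict_strip_eq_prod' :
    (volume.restrict strip : Measure (ℝ × ℝ)) = (volume.restrict (Ioi (0:ℝ))).prod (volume.restrict (Ioo 0 (π / 2))) := by
  rw [show strip = Ioi (0:ℝ) ×ˢ Ioo 0 (π / 2) from rfl, Measure.volume_eq_prod, Measure.prod_restrict]

/-- Tonelli on the strip, `z` outside, for a.e.-measurable integrands. [folklore] -/
theorem lintegral_strip_eq_radial_theta_ae {F : ℝ × ℝ → ℝ≥0∞} (hF : AEMeasurable F (volume.restrict strip)) :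
    ∫⁻ p in strip, F p = ∫⁻ z in Ioi 0, ∫⁻ t in Ioo 0 (π / 2), F (z, t) := by
  rw [volume_restrict_strip_eq_prod'] at hF ⊢
  rw [lintegral_prod _ hF]

/-- The inner slice integral is a.e.-measurable in `z`. [folklore] -/
theorem aemeasurable_lintegral_slice {F : ℝ × ℝ → ℝ≥0∞} (hF : AEMeasurable F (volume.restrict strip)) :
    AEMeasurable (fun z => ∫⁻ t in Ioo 0 (π / 2), F (z, t)) (volume.restrict (Ioi 0)) := by
  rw [volume_restrict_strip_eq_prod'] at hF
  exact hF.lintegral_prod_right'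

/-- From a real inequality between integrals of nonnegative integrable functions on `(0, π/2)` to the
`ℝ≥0∞` inequality between the lower integrals. [folklore] -/
theorem lintegral_ofReal_le_of_integral_le {A B : ℝ → ℝ} (hA : IntegrableOn A (Ioo 0 (π / 2))) (hB : IntegrableOn B (Ioo 0 (π / 2)))
    (nA : ∀ θ ∈ Ioo 0 (π / 2), 0 ≤ A θ) (nB : ∀ θ ∈ Ioo 0 (π / 2), 0 ≤ B θ) {K : ℝ} (hK : 0 ≤ K)
    (h : ∫ θ in Ioo 0 (π / 2), A θ ≤ K * ∫ θ in Ioo 0 (π / 2), B θ) :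
    ∫⁻ θ in Ioo 0 (π / 2), ENNReal.ofReal (A θ) ≤ ENNReal.ofReal K * ∫⁻ θ in Ioo 0 (π / 2), ENNReal.ofReal (B θ) := by
  rw [← ofReal_integral_eq_lintegral_ofReal hA ((ae_restrict_iff' measurableSet_Ioo).2 (ae_of_all _ nA)),
    ← ofReal_integral_eq_lintegral_ofReal hB ((ae_restrict_iff' measurableSet_Ioo).2 (ae_of_all _ nB)), ← ENNReal.ofReal_mul hK]
  exact ENNReal.ofReal_le_ofReal h

/-- The same for finite families with a lower-order term. [folklore] -/
theorem sum_lintegral_ofReal_le_of_integral_le {n : ℕ} {A B : ℕ → ℝ → ℝ} {B₀ : ℝ → ℝ}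
    (hA : ∀ i < n, IntegrableOn (A i) (Ioo 0 (π / 2))) (hB : ∀ i < n, IntegrableOn (B i) (Ioo 0 (π / 2)))
    (hB₀ : IntegrableOn B₀ (Ioo 0 (π / 2)))
    (nA : ∀ i < n, ∀ θ ∈ Ioo 0 (π / 2), 0 ≤ A i θ) (nB : ∀ i < n, ∀ θ ∈ Ioo 0 (π / 2), 0 ≤ B i θ) (nB₀ : ∀ θ ∈ Ioo 0 (π / 2), 0 ≤ B₀ θ)
    {K : ℝ} (hK : 0 ≤ K)
    (h : (∑ i ∈ range n, ∫ θ in Ioo 0 (π / 2), A i θ) ≤ K * ((∑ i ∈ range n, ∫ θ in Ioo 0 (π / 2), B i θ) + ∫ θ in Ioo 0 (π / 2), B₀ θ)) :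
    (∑ i ∈ range n, ∫⁻ θ in Ioo 0 (π / 2), ENNReal.ofReal (A i θ)) ≤
      ENNReal.ofReal K * ((∑ i ∈ range n, ∫⁻ θ in Ioo 0 (π / 2), ENNReal.ofReal (B i θ)) + ∫⁻ θ in Ioo 0 (π / 2), ENNReal.ofReal (B₀ θ)) := by
  have nn : ∀ {C : ℝ → ℝ}, (∀ θ ∈ Ioo 0 (π / 2), 0 ≤ C θ) → 0 ≤ᵐ[volume.restrict (Ioo 0 (π / 2))] C := fun hC =>
    (ae_restrict_iff' measurableSet_Ioo).2 (ae_of_all _ hC)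
  have eA : ∑ i ∈ range n, ∫⁻ θ in Ioo 0 (π / 2), ENNReal.ofReal (A i θ) = ENNReal.ofReal (∑ i ∈ range n, ∫ θ in Ioo 0 (π / 2), A i θ) := by
    rw [ENNReal.ofReal_sum_of_nonneg (fun i hi => setIntegral_nonneg measurableSet_Ioo (nA i (mem_range.1 hi)))]
    exact Finset.sum_congr rfl fun i hi => (ofReal_integral_eq_lintegral_ofReal (hA i (mem_range.1 hi)) (nn (nA i (mem_range.1 hi)))).symm
  have eB : ∑ i ∈ range n, ∫⁻ θ in Ioo 0 (π / 2), ENNReal.ofReal (B i θ) = ENNReal.ofReal (∑ i ∈ range n, ∫ θ in Ioo 0 (π / 2), B i θ) := by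
    rw [ENNReal.ofReal_sum_of_nonneg (fun i hi => setIntegral_nonneg measurableSet_Ioo (nB i (mem_range.1 hi)))]
    exact Finset.sum_congr rfl fun i hi => (ofReal_integral_eq_lintegral_ofReal (hB i (mem_range.1 hi)) (nn (nB i (mem_range.1 hi)))).symm
  have eB₀ : ∫⁻ θ in Ioo 0 (π / 2), ENNReal.ofReal (B₀ θ) = ENNReal.ofReal (∫ θ in Ioo 0 (π / 2), B₀ θ) :=
    (ofReal_integral_eq_lintegral_ofReal hB₀ (nn nB₀)).symm
  have hS : 0 ≤ ∑ i ∈ range n, ∫ θ in Ioo 0 (π / 2), B i θ := Finset.sum_nonneg fun i hi => setIntegral_nonneg measurableSet_Ioo (nB i (mem_range.1 hi))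
  have h0 : 0 ≤ ∫ θ in Ioo 0 (π / 2), B₀ θ := setIntegral_nonneg measurableSet_Ioo nB₀
  rw [eA, eB, eB₀, ← ENNReal.ofReal_add hS h0, ← ENNReal.ofReal_mul hK]
  exact ENNReal.ofReal_le_ofReal h

/-! ### The slice inequalities -/

section Slices

variable {Φ : ℝ → ℝ → ℝ} (hΦ : Smooth2 Φ) (h0 : ∀ z, Φ z 0 = 0) (h1 : ∀ z, Φ z (π / 2) = 0)
include hΦ h0 h1

/-- **The radial slice inequality** (level zero, sharp Hardy): for `z > 0` and any `j`,
`∫ ((D_zʲΦ)(z,θ)/sin 2θ)² S^{−η} dθ ≤ ∫ ((D_zʲ∂_θΦ)(z,θ))² S^{−η} dθ`, with both integrands integrable. [cite: Elgindi2021, §7.2 Corollary 7.6 and §8.5 Proposition 8.21 (pp. 20, 28 of arXiv:1904.04795)] -/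
theorem slice_radial_le (j : ℕ) {z : ℝ} (hz : 0 < z) :
    IntegrableOn (fun θ => ((Dz^[j] Φ) z θ / Real.sin (2 * θ)) ^ 2 * Real.sin (2 * θ) ^ (-eta)) (Ioo 0 (π / 2)) ∧
    IntegrableOn (fun θ => (Dz^[j] (dθ Φ)) z θ ^ 2 * Real.sin (2 * θ) ^ (-eta)) (Ioo 0 (π / 2)) ∧
    ∫ θ in Ioo 0 (π / 2), ((Dz^[j] Φ) z θ / Real.sin (2 * θ)) ^ 2 * Real.sin (2 * θ) ^ (-eta) ≤
      ∫ θ in Ioo 0 (π / 2), (Dz^[j] (dθ Φ)) z θ ^ 2 * Real.sin (2 * θ) ^ (-eta) := by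
  set f : ℝ → ℝ := fun θ => (Dz^[j] Φ) z θ with hf
  have hfs : ContDiff ℝ ∞ f := Smooth2.contDiff_slice_iterate_Dz hΦ j z
  have hf1 : ContDiff ℝ 1 f := hfs.of_le one_le_infty'
  have hf0 : f 0 = 0 := iterate_Dz_apply_eq_zero h0 j z
  have hfp : f (π / 2) = 0 := iterate_Dz_apply_eq_zero h1 j z
  have hη1 : eta < 1 := by norm_num [eta]
  have hH := sharpHardy_sin_two_mul' eta_pos.le hη1 hf1 hf0 hfp
  have hd : ∀ θ ∈ Ioo 0 (π / 2), deriv f θ = (Dz^[j] (dθ Φ)) z θ := fun θ hθ =>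
    Smooth2.dθ_iterate_Dz hΦ j (p := (z, θ)) ⟨hz, hθ⟩
  have hhs : ContDiff ℝ ∞ fun θ => (Dz^[j] (dθ Φ)) z θ := Smooth2.contDiff_slice_iterate_Dz (Smooth2.smooth2_dθ hΦ) j z
  have e : ∫ θ in Ioo 0 (π / 2), deriv f θ ^ 2 * Real.sin (2 * θ) ^ (-eta) = ∫ θ in Ioo 0 (π / 2), (Dz^[j] (dθ Φ)) z θ ^ 2 * Real.sin (2 * θ) ^ (-eta) :=
    setIntegral_congr_fun measurableSet_Ioo fun θ hθ => by rw [hd θ hθ]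
  refine ⟨integrableOn_div_sin_sq_mul_rpow eta_pos.le hη1 hf1 hf0 hfp, integrableOn_sq_mul_sin_rpow_neg_eta hhs.continuous, ?_⟩
  rw [← e]
  refine hH.trans ?_
  have hn : 0 ≤ ∫ θ in Ioo 0 (π / 2), deriv f θ ^ 2 * Real.sin (2 * θ) ^ (-eta) := wsq_nonneg (-eta) (deriv f)
  have hc : 1 / (eta + 1) ^ 2 ≤ 1 := by norm_num [eta]
  calc 1 / (eta + 1) ^ 2 * ∫ θ in Ioo 0 (π / 2), deriv f θ ^ 2 * Real.sin (2 * θ) ^ (-eta)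
      ≤ 1 * ∫ θ in Ioo 0 (π / 2), deriv f θ ^ 2 * Real.sin (2 * θ) ^ (-eta) := mul_le_mul_of_nonneg_right hc hn
    _ = _ := one_mul _

/-- **The angular slice inequality** (Proposition 8.21, one slice): for `0 < α ≤ 1` (`γ = 1 + α/10`),
`z > 0` and `n ≤ 4`, with `g = (D_zʲΦ)(z,·)/sin 2θ` and `h = (D_zʲ∂_θΦ)(z,·)`,
`Σ_{i<n} ∫ (D_θ^{i+1}g)² S^{−γ} ≤ 10³⁰·(Σ_{i<n} ∫ (D_θ^{i+1}h)² S^{−γ} + ∫ h² S^{−η})`, and the word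
integrands are integrable. [cite: Elgindi2021, §8.5 Proposition 8.21 with Lemma 8.23 (pp. 28–29 of arXiv:1904.04795)] -/
theorem slice_mixed_le {α : ℝ} (hα : 0 < α) (hα1 : α ≤ 1) (j : ℕ) {z : ℝ} (hz : 0 < z) {n : ℕ} (hn : n ≤ 4) :
    (∀ i < n, IntegrableOn (fun θ => (Dθ₁^[i + 1] fun θ' => (Dz^[j] Φ) z θ' / Real.sin (2 * θ')) θ ^ 2 * Real.sin (2 * θ) ^ (-gammaExp α))
      (Ioo 0 (π / 2))) ∧
    (∀ i < n, IntegrableOn (fun θ => (Dθ₁^[i + 1] fun θ' => (Dz^[j] (dθ Φ)) z θ') θ ^ 2 * Real.sin (2 * θ) ^ (-gammaExp α)) (Ioo 0 (π / 2))) ∧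
    (∑ i ∈ range n, ∫ θ in Ioo 0 (π / 2), (Dθ₁^[i + 1] fun θ' => (Dz^[j] Φ) z θ' / Real.sin (2 * θ')) θ ^ 2 * Real.sin (2 * θ) ^ (-gammaExp α)) ≤
      10 ^ 30 * ((∑ i ∈ range n, ∫ θ in Ioo 0 (π / 2), (Dθ₁^[i + 1] fun θ' => (Dz^[j] (dθ Φ)) z θ') θ ^ 2 * Real.sin (2 * θ) ^ (-gammaExp α)) +
        ∫ θ in Ioo 0 (π / 2), (Dz^[j] (dθ Φ)) z θ ^ 2 * Real.sin (2 * θ) ^ (-eta)) := by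
  set γ := gammaExp α with hγ
  have hγ1 : 1 < γ := by rw [hγ]; unfold gammaExp; linarith
  have hγ2 : γ ≤ 11 / 10 := by rw [hγ]; unfold gammaExp; linarith
  have hγ3 : γ < 2 := by linarith
  set f : ℝ → ℝ := fun θ => (Dz^[j] Φ) z θ with hf
  set g : ℝ → ℝ := fun θ' => (Dz^[j] Φ) z θ' / Real.sin (2 * θ') with hgdef
  set h : ℝ → ℝ := fun θ' => (Dz^[j] (dθ Φ)) z θ' with hhdef
  have hfs : ContDiff ℝ ∞ f := Smooth2.contDiff_slice_iterate_Dz hΦ j z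
  have hf0 : f 0 = 0 := iterate_Dz_apply_eq_zero h0 j z
  have hfp : f (π / 2) = 0 := iterate_Dz_apply_eq_zero h1 j z
  have hhs : ContDiff ℝ ∞ h := Smooth2.contDiff_slice_iterate_Dz (Smooth2.smooth2_dθ hΦ) j z
  obtain ⟨G, hGs, hfG⟩ := exists_smooth_div_sin_two_mul hfs hf0 hfp
  have hgG : ∀ θ ∈ Ioo 0 (π / 2), g θ = G θ := fun θ hθ => by
    have hs := (sin_two_mul_pos_of_mem hθ).ne'
    simp only [hgdef]; rw [show (Dz^[j] Φ) z θ = f θ from rfl, hfG θ hθ]; field_simp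
  have hd : ∀ θ ∈ Ioo 0 (π / 2), deriv f θ = h θ := fun θ hθ => Smooth2.dθ_iterate_Dz hΦ j (p := (z, θ)) ⟨hz, hθ⟩
  have hdG : ∀ θ ∈ Ioo 0 (π / 2), deriv (fun x => Real.sin (2 * x) * G x) θ = h θ := fun θ hθ => by
    rw [deriv_congr_Ioo (fun θ' hθ' => (hfG θ' hθ').symm) θ hθ]; exact hd θ hθ
  have core := divisionBySin_core hγ1 hγ2 hGs hn
  -- congruences on the open quarter period
  have e1 : ∀ i, wsq (-γ) (Dθ₁^[i + 1] g) = wsq (-γ) (Dθ₁^[i + 1] G) := fun i =>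
    wsq_congr fun θ hθ => by rw [iterate_Dθ₁_congr_of_Ioo hgG (i + 1) θ hθ]
  have e2 : ∀ i, wsq (-γ) (Dθ₁^[i + 1] (deriv fun x => Real.sin (2 * x) * G x)) = wsq (-γ) (Dθ₁^[i + 1] h) := fun i =>
    wsq_congr fun θ hθ => by rw [iterate_Dθ₁_congr_of_Ioo hdG (i + 1) θ hθ]
  have e3 : wsq (-eta) (deriv fun x => Real.sin (2 * x) * G x) = wsq (-eta) h := wsq_congr fun θ hθ => by rw [hdG θ hθ]
  simp only [e2, e3] at core
  -- integrability
  obtain ⟨iG, -⟩ := wsq_iterate_Dθ₁_le hγ3 hGs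
  obtain ⟨ih, -⟩ := wsq_iterate_Dθ₁_le hγ3 hhs
  have iA : ∀ i < n, IntegrableOn (fun θ => (Dθ₁^[i + 1] g) θ ^ 2 * Real.sin (2 * θ) ^ (-γ)) (Ioo 0 (π / 2)) := fun i hi =>
    (iG (i + 1) (by omega) (by omega)).congr_fun (fun θ hθ => by rw [iterate_Dθ₁_congr_of_Ioo hgG (i + 1) θ hθ]) measurableSet_Ioo
  refine ⟨iA, fun i hi => ih (i + 1) (by omega) (by omega), ?_⟩
  have eL : (∑ i ∈ range n, ∫ θ in Ioo 0 (π / 2), (Dθ₁^[i + 1] g) θ ^ 2 * Real.sin (2 * θ) ^ (-γ)) = ∑ i ∈ range n, wsq (-γ) (Dθ₁^[i + 1] G) :=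
    Finset.sum_congr rfl fun i _ => e1 i
  rw [eL]
  exact core

end Slices


/-! ### The strip inequality -/

section Strip

variable {Φ : ℝ → ℝ → ℝ} (hΦ : Smooth2 Φ) (h0 : ∀ z, Φ z 0 = 0) (h1 : ∀ z, Φ z (π / 2) = 0)
include hΦ h0 h1

/-- **The radial terms**: `‖D_zʲ(Φ/sin 2θ)·w/s^{η/2}‖² ≤ ‖D_zʲ∂_θΦ·w/s^{η/2}‖²` for every `j`. [cite: Elgindi2021, §8.5 Proposition 8.21 (p. 28 of arXiv:1904.04795), radial part] -/
theorem eL2Sq_hkRadialTerm_div_sin_le (j : ℕ) :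
    eL2Sq (hkRadialTerm j fun z θ => Φ z θ / Real.sin (2 * θ)) ≤ eL2Sq (hkRadialTerm j (dθ Φ)) := by
  set Q : ℝ → ℝ → ℝ := fun z θ => Φ z θ / Real.sin (2 * θ) with hQ
  have eQ : Dz^[j] Q = fun z θ => (Dz^[j] Φ) z θ / Real.sin (2 * θ) := iterate_Dz_div_theta Φ _ j
  have mQ : AEMeasurable (fun p : ℝ × ℝ => ENNReal.ofReal ((hkRadialTerm j Q p.1 p.2) ^ 2)) (volume.restrict strip) :=
    ((aemeasurable_hkRadialTerm_strip (Smooth2.contDiffOn_div_sin hΦ j) le_rfl).pow_const 2).ennreal_ofReal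
  have mD : AEMeasurable (fun p : ℝ × ℝ => ENNReal.ofReal ((hkRadialTerm j (dθ Φ) p.1 p.2) ^ 2)) (volume.restrict strip) :=
    ((aemeasurable_hkRadialTerm_strip (Smooth2.contDiffOn_strip (Smooth2.smooth2_dθ hΦ) j) le_rfl).pow_const 2).ennreal_ofReal
  rw [eL2Sq_eq_lintegral_ofReal, eL2Sq_eq_lintegral_ofReal, lintegral_strip_eq_radial_theta_ae mQ, lintegral_strip_eq_radial_theta_ae mD]
  refine setLIntegral_mono' measurableSet_Ioi fun z hz => ?_
  have hz' : 0 < z := hz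
  obtain ⟨iA, iB, hle⟩ := slice_radial_le hΦ h0 h1 j hz'
  have hw : 0 ≤ radialWeight z ^ 2 := sq_nonneg _
  set A : ℝ → ℝ := fun θ => radialWeight z ^ 2 * (((Dz^[j] Φ) z θ / Real.sin (2 * θ)) ^ 2 * Real.sin (2 * θ) ^ (-eta)) with hA
  set B : ℝ → ℝ := fun θ => radialWeight z ^ 2 * ((Dz^[j] (dθ Φ)) z θ ^ 2 * Real.sin (2 * θ) ^ (-eta)) with hB
  have eA : ∀ θ ∈ Ioo (0:ℝ) (π / 2), ENNReal.ofReal ((hkRadialTerm j Q z θ) ^ 2) = ENNReal.ofReal (A θ) := fun θ hθ => by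
    rw [sq_hkRadialTerm j Q (p := (z, θ)) ⟨hz', hθ⟩]
    simp only [eQ, hA]; congr 1; ring
  have eB : ∀ θ ∈ Ioo (0:ℝ) (π / 2), ENNReal.ofReal ((hkRadialTerm j (dθ Φ) z θ) ^ 2) = ENNReal.ofReal (B θ) := fun θ hθ => by
    rw [sq_hkRadialTerm j (dθ Φ) (p := (z, θ)) ⟨hz', hθ⟩]
    simp only [hB]; congr 1; ring
  rw [setLIntegral_congr_fun measurableSet_Ioo eA, setLIntegral_congr_fun measurableSet_Ioo eB]
  have hle' : ∫ θ in Ioo 0 (π / 2), A θ ≤ 1 * ∫ θ in Ioo 0 (π / 2), B θ := by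
    simp only [hA, hB, MeasureTheory.integral_const_mul, one_mul]
    exact mul_le_mul_of_nonneg_left hle hw
  have h := lintegral_ofReal_le_of_integral_le (iA.const_mul _) (iB.const_mul _)
    (fun θ hθ => mul_nonneg hw (mul_nonneg (sq_nonneg _) (Real.rpow_nonneg (sin_two_mul_pos_of_mem hθ).le _)))
    (fun θ hθ => mul_nonneg hw (mul_nonneg (sq_nonneg _) (Real.rpow_nonneg (sin_two_mul_pos_of_mem hθ).le _))) zero_le_one hle'
  rwa [ENNReal.ofReal_one, one_mul] at h

/-- **The angular words at fixed `j`**: for `0 < α ≤ 1` and `n + j ≤ 4`,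
`Σ_{i<n} ‖D_θ^{i+1}D_zʲ(Φ/sin 2θ)·W‖² ≤ 10³⁰·(Σ_{i<n} ‖D_θ^{i+1}D_zʲ∂_θΦ·W‖² + ‖D_zʲ∂_θΦ·w/s^{η/2}‖²)`. [cite: Elgindi2021, §8.5 Proposition 8.21 with Lemma 8.23 (pp. 28–29 of arXiv:1904.04795)] -/
theorem sum_eL2Sq_hkMixedTerm_div_sin_le {α : ℝ} (hα : 0 < α) (hα1 : α ≤ 1) {j n : ℕ} (hnj : n + j ≤ 4) :
    (∑ i ∈ range n, eL2Sq (hkMixedTerm α (i + 1) j fun z θ => Φ z θ / Real.sin (2 * θ))) ≤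
      ENNReal.ofReal (10 ^ 30) * ((∑ i ∈ range n, eL2Sq (hkMixedTerm α (i + 1) j (dθ Φ))) + eL2Sq (hkRadialTerm j (dθ Φ))) := by
  set Q : ℝ → ℝ → ℝ := fun z θ => Φ z θ / Real.sin (2 * θ) with hQ
  have eQ : Dz^[j] Q = fun z θ => (Dz^[j] Φ) z θ / Real.sin (2 * θ) := iterate_Dz_div_theta Φ _ j
  set γ := gammaExp α with hγ
  have hdθ : Smooth2 (dθ Φ) := Smooth2.smooth2_dθ hΦ
  -- measurability
  have mQ : ∀ i, AEMeasurable (fun p : ℝ × ℝ => ENNReal.ofReal ((hkMixedTerm α (i + 1) j Q p.1 p.2) ^ 2)) (volume.restrict strip) := fun i =>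
    ((aemeasurable_hkMixedTerm_strip α (Smooth2.contDiffOn_div_sin hΦ (i + 1 + j)) le_rfl).pow_const 2).ennreal_ofReal
  have mD : ∀ i, AEMeasurable (fun p : ℝ × ℝ => ENNReal.ofReal ((hkMixedTerm α (i + 1) j (dθ Φ) p.1 p.2) ^ 2)) (volume.restrict strip) := fun i =>
    ((aemeasurable_hkMixedTerm_strip α (Smooth2.contDiffOn_strip hdθ (i + 1 + j)) le_rfl).pow_const 2).ennreal_ofReal
  have mR : AEMeasurable (fun p : ℝ × ℝ => ENNReal.ofReal ((hkRadialTerm j (dθ Φ) p.1 p.2) ^ 2)) (volume.restrict strip) :=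
    ((aemeasurable_hkRadialTerm_strip (Smooth2.contDiffOn_strip hdθ j) le_rfl).pow_const 2).ennreal_ofReal
  -- iterated integrals
  have L : ∀ i, eL2Sq (hkMixedTerm α (i + 1) j Q) = ∫⁻ z in Ioi 0, ∫⁻ θ in Ioo 0 (π / 2), ENNReal.ofReal ((hkMixedTerm α (i + 1) j Q z θ) ^ 2) :=
    fun i => by rw [eL2Sq_eq_lintegral_ofReal, lintegral_strip_eq_radial_theta_ae (mQ i)]
  have RD : ∀ i, eL2Sq (hkMixedTerm α (i + 1) j (dθ Φ)) = ∫⁻ z in Ioi 0, ∫⁻ θ in Ioo 0 (π / 2), ENNReal.ofReal ((hkMixedTerm α (i + 1) j (dθ Φ) z θ) ^ 2) :=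
    fun i => by rw [eL2Sq_eq_lintegral_ofReal, lintegral_strip_eq_radial_theta_ae (mD i)]
  have RR : eL2Sq (hkRadialTerm j (dθ Φ)) = ∫⁻ z in Ioi 0, ∫⁻ θ in Ioo 0 (π / 2), ENNReal.ofReal ((hkRadialTerm j (dθ Φ) z θ) ^ 2) := by
    rw [eL2Sq_eq_lintegral_ofReal, lintegral_strip_eq_radial_theta_ae mR]
  simp only [L, RD, RR]
  rw [← lintegral_finsetSum' _ (fun i _ => aemeasurable_lintegral_slice (mQ i)),
    ← lintegral_finsetSum' _ (fun i _ => aemeasurable_lintegral_slice (mD i)),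
    ← lintegral_add_left' (Finset.aemeasurable_fun_sum _ fun i _ => aemeasurable_lintegral_slice (mD i)),
    ← lintegral_const_mul' _ _ ENNReal.ofReal_ne_top]
  refine setLIntegral_mono' measurableSet_Ioi fun z hz => ?_
  have hz' : 0 < z := hz
  -- the slice at `z > 0`
  obtain ⟨iA, iB, hle⟩ := slice_mixed_le hΦ h0 h1 hα hα1 j hz' (n := n) (by omega)
  obtain ⟨-, iB₀, -⟩ := slice_radial_le hΦ h0 h1 j hz'
  have hw : 0 ≤ radialWeight z ^ 2 := sq_nonneg _
  set A : ℕ → ℝ → ℝ := fun i θ => radialWeight z ^ 2 *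
    ((Dθ₁^[i + 1] fun θ' => (Dz^[j] Φ) z θ' / Real.sin (2 * θ')) θ ^ 2 * Real.sin (2 * θ) ^ (-γ)) with hA
  set B : ℕ → ℝ → ℝ := fun i θ => radialWeight z ^ 2 * ((Dθ₁^[i + 1] fun θ' => (Dz^[j] (dθ Φ)) z θ') θ ^ 2 * Real.sin (2 * θ) ^ (-γ)) with hB
  set B₀ : ℝ → ℝ := fun θ => radialWeight z ^ 2 * ((Dz^[j] (dθ Φ)) z θ ^ 2 * Real.sin (2 * θ) ^ (-eta)) with hB₀
  have eA : ∀ i, ∀ θ ∈ Ioo (0:ℝ) (π / 2), ENNReal.ofReal ((hkMixedTerm α (i + 1) j Q z θ) ^ 2) = ENNReal.ofReal (A i θ) := fun i θ hθ => by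
    rw [sq_hkMixedTerm α (i + 1) j Q (p := (z, θ)) ⟨hz', hθ⟩]
    simp only [eQ, iterate_Dθ_apply, hA]; congr 1; ring
  have eB : ∀ i, ∀ θ ∈ Ioo (0:ℝ) (π / 2), ENNReal.ofReal ((hkMixedTerm α (i + 1) j (dθ Φ) z θ) ^ 2) = ENNReal.ofReal (B i θ) := fun i θ hθ => by
    rw [sq_hkMixedTerm α (i + 1) j (dθ Φ) (p := (z, θ)) ⟨hz', hθ⟩]
    simp only [iterate_Dθ_apply, hB]; congr 1; ring
  have eB₀ : ∀ θ ∈ Ioo (0:ℝ) (π / 2), ENNReal.ofReal ((hkRadialTerm j (dθ Φ) z θ) ^ 2) = ENNReal.ofReal (B₀ θ) := fun θ hθ => by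
    rw [sq_hkRadialTerm j (dθ Φ) (p := (z, θ)) ⟨hz', hθ⟩]
    simp only [hB₀]; congr 1; ring
  rw [Finset.sum_congr rfl fun i _ => setLIntegral_congr_fun measurableSet_Ioo (eA i),
    Finset.sum_congr rfl fun i _ => setLIntegral_congr_fun measurableSet_Ioo (eB i), setLIntegral_congr_fun measurableSet_Ioo eB₀]
  -- the real inequality with the radial weight
  have hle' : (∑ i ∈ range n, ∫ θ in Ioo 0 (π / 2), A i θ) ≤ 10 ^ 30 * ((∑ i ∈ range n, ∫ θ in Ioo 0 (π / 2), B i θ) + ∫ θ in Ioo 0 (π / 2), B₀ θ) := by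
    simp only [hA, hB, hB₀, MeasureTheory.integral_const_mul, ← Finset.mul_sum]
    have h := mul_le_mul_of_nonneg_left hle hw
    have e : radialWeight z ^ 2 * (10 ^ 30 * ((∑ i ∈ range n, ∫ θ in Ioo 0 (π / 2),
        (Dθ₁^[i + 1] fun θ' => (Dz^[j] (dθ Φ)) z θ') θ ^ 2 * Real.sin (2 * θ) ^ (-γ)) +
        ∫ θ in Ioo 0 (π / 2), (Dz^[j] (dθ Φ)) z θ ^ 2 * Real.sin (2 * θ) ^ (-eta))) =
        10 ^ 30 * (radialWeight z ^ 2 * (∑ i ∈ range n, ∫ θ in Ioo 0 (π / 2),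
        (Dθ₁^[i + 1] fun θ' => (Dz^[j] (dθ Φ)) z θ') θ ^ 2 * Real.sin (2 * θ) ^ (-γ)) +
        radialWeight z ^ 2 * ∫ θ in Ioo 0 (π / 2), (Dz^[j] (dθ Φ)) z θ ^ 2 * Real.sin (2 * θ) ^ (-eta)) := by ring
    linarith
  have nn : ∀ (u : ℝ) {θ : ℝ}, θ ∈ Ioo (0:ℝ) (π / 2) → ∀ q : ℝ, 0 ≤ radialWeight z ^ 2 * (u ^ 2 * Real.sin (2 * θ) ^ q) := fun u θ hθ q =>
    mul_nonneg hw (mul_nonneg (sq_nonneg _) (Real.rpow_nonneg (sin_two_mul_pos_of_mem hθ).le _))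
  exact sum_lintegral_ofReal_le_of_integral_le (fun i hi => (iA i hi).const_mul _) (fun i hi => (iB i hi).const_mul _) (iB₀.const_mul _)
    (fun i _ θ hθ => nn _ hθ _) (fun i _ θ hθ => nn _ hθ _) (fun θ hθ => nn _ hθ _) (by norm_num) hle'

/-- **Proposition 8.21 of [Elgindi2021] in the tree's `𝓗⁴` functional**: for `Φ` smooth on `ℝ²`
vanishing on the sides `θ = 0`, `θ = π/2` and `0 < α ≤ 1`,
`|Φ/sin 2θ|²_{𝓗⁴} ≤ 1.5·10³²·|∂_θΦ|²_{𝓗⁴}` (`eHkNormSq α 4`; the printed `|Φ/sin 2θ|_{𝓗⁴} ≤ C|∂_θΦ|_{𝓗⁴}`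
with an explicit, non-optimised constant). [cite: Elgindi2021, §8.5 Proposition 8.21 (p. 28 of arXiv:1904.04795)] -/
theorem eHkNormSq_div_sin_le {α : ℝ} (hα : 0 < α) (hα1 : α ≤ 1) :
    eHkNormSq α 4 (fun z θ => Φ z θ / Real.sin (2 * θ)) ≤ ENNReal.ofReal (15 * 10 ^ 31) * eHkNormSq α 4 (dθ Φ) := by
  set Q : ℝ → ℝ → ℝ := fun z θ => Φ z θ / Real.sin (2 * θ) with hQ
  set E := eHkNormSq α 4 (dθ Φ) with hE
  have hB := eHkNormSq_le_of_forall_le (α := α) (k := 4) (f := Q) (B := ENNReal.ofReal (5 * 10 ^ 30) * E)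
    (fun j hj => by
      refine (eL2Sq_hkRadialTerm_div_sin_le hΦ h0 h1 j).trans ((eL2Sq_hkRadialTerm_le α hj (dθ Φ)).trans ?_)
      rw [← hE]
      calc E = 1 * E := (one_mul E).symm
        _ ≤ ENNReal.ofReal (5 * 10 ^ 30) * E := by
            gcongr; rw [← ENNReal.ofReal_one]; exact ENNReal.ofReal_le_ofReal (by norm_num))
    (fun i j hi hij => by
      obtain ⟨i', rfl⟩ : ∃ i', i = i' + 1 := ⟨i - 1, by omega⟩
      have hs : eL2Sq (hkMixedTerm α (i' + 1) j Q) ≤ ∑ i ∈ range (4 - j), eL2Sq (hkMixedTerm α (i + 1) j Q) :=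
        Finset.single_le_sum (f := fun i => eL2Sq (hkMixedTerm α (i + 1) j Q)) (fun _ _ => bot_le) (mem_range.2 (by omega))
      refine hs.trans ((sum_eL2Sq_hkMixedTerm_div_sin_le hΦ h0 h1 hα hα1 (n := 4 - j) (j := j) (by omega)).trans ?_)
      have h5 : (∑ i ∈ range (4 - j), eL2Sq (hkMixedTerm α (i + 1) j (dθ Φ))) + eL2Sq (hkRadialTerm j (dθ Φ)) ≤ 5 * E := by
        have hsum : (∑ i ∈ range (4 - j), eL2Sq (hkMixedTerm α (i + 1) j (dθ Φ))) ≤ 4 * E := by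
          have h1' : ∀ i ∈ range (4 - j), eL2Sq (hkMixedTerm α (i + 1) j (dθ Φ)) ≤ E := fun i hi =>
            eL2Sq_hkMixedTerm_le α (by omega) (by have := mem_range.1 hi; omega) (dθ Φ)
          calc (∑ i ∈ range (4 - j), eL2Sq (hkMixedTerm α (i + 1) j (dθ Φ))) ≤ ∑ _i ∈ range (4 - j), E := Finset.sum_le_sum h1'
            _ = ((4 - j : ℕ) : ℝ≥0∞) * E := by rw [Finset.sum_const, Finset.card_range, nsmul_eq_mul]
            _ ≤ 4 * E := by gcongr; exact_mod_cast Nat.sub_le 4 j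
        have hr : eL2Sq (hkRadialTerm j (dθ Φ)) ≤ E := eL2Sq_hkRadialTerm_le α (by omega) (dθ Φ)
        calc (∑ i ∈ range (4 - j), eL2Sq (hkMixedTerm α (i + 1) j (dθ Φ))) + eL2Sq (hkRadialTerm j (dθ Φ)) ≤ 4 * E + E := add_le_add hsum hr
          _ = 5 * E := by ring
      calc ENNReal.ofReal (10 ^ 30) * ((∑ i ∈ range (4 - j), eL2Sq (hkMixedTerm α (i + 1) j (dθ Φ))) + eL2Sq (hkRadialTerm j (dθ Φ)))
          ≤ ENNReal.ofReal (10 ^ 30) * (5 * E) := by gcongr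
        _ = ENNReal.ofReal (5 * 10 ^ 30) * E := by
            rw [← mul_assoc, show (5 : ℝ≥0∞) = ENNReal.ofReal 5 by norm_num, ← ENNReal.ofReal_mul (by norm_num)]
            norm_num)
  refine hB.trans (le_of_eq ?_)
  rw [← mul_assoc]
  congr 1
  rw [show (((4 + 1) + (4 + 1) ^ 2 : ℕ) : ℝ≥0∞) = ENNReal.ofReal 30 by norm_num, ← ENNReal.ofReal_mul (by norm_num)]
  norm_num

end Strip


end Elgindi

end Literature.Analysis.FluidPDE
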